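import Mathlib
import HarnessLib

/-!
# Burgers-tube heredity (instab lane, door O-acc = O7, obstruction P3): the axis gradient of a
# columnar swirl in axisymmetric strain, and the Lamb–Oseen strain bound

HONEST FRAMING (cell `ns-blowup`, seat `ns-blowup-instab2`; human ruling D-0035): nothing here is a
claim about Navier–Stokes blow-up. WHAT THIS IS NOT: not dynamics of any real flow; it is the
elementary algebra/calculus behind `HOME/instab2/HEREDITY-P3.md` (A)(i) and (B):

* (A)(i) the velocity gradient at the axis stagnation point of the columnar swirl
  `u = −(σ r/2) e_r + r Ω(r) e_θ + σ z e_z` (the Burgers/Lundgren family in the parent's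
  axisymmetric strain `σ`) is `!![−σ/2, −Ω₀, 0; Ω₀, −σ/2, 0; 0, 0, σ]`
  (`Ω₀ = Ω(0)`): trace `0`, symmetric part `diag(−σ/2, −σ/2, σ)` = the PARENT's strain (the tube
  contributes the rotation only), determinant `σ(σ²/4 + Ω₀²) ≠ 0` (non-degenerate), real
  characteristic polynomial `(σ − μ)((μ + σ/2)² + Ω₀²)` — so for `Ω₀ ≠ 0` the only real eigenvalue is
  the parent's stretching `σ` (axis eigenvector `e_z`), the transverse pair being `−σ/2 ± iΩ₀`;
* (B) the in-plane rate of strain of a Gaussian (Lamb–Oseen/Burgers) core of peak vorticity `ω₀`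
  and radius `a` at radius `r = x·a` is `ω₀ · s(x)` with
  `s(x) = (1 − (1 + x²) e^{−x²}) / (2x²)`; we prove the elementary bounds
  `0 ≤ 1 − (1+y)e^{−y} ≤ min(1, y²/2)` (`y ≥ 0`) and hence `0 ≤ s(x) ≤ min(x²/4, 1/(2x²)) ≤ √2/4`:
  a single Gaussian tube offers strain `< 0.36 ω₀` anywhere (numerically the maximum is `0.149 ω₀`
  at `r = 1.34 a`), against the marginal schedule's child-site strain `σ* = A_k = ω₀` — heredity's
  strain half costs a constant, located off the core (`HEREDITY-P3.md` (B)).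

Mathlib only. LABEL: MODEL/kinematic bookkeeping; the fluid reading is in the memo.
-/

namespace Summit.NavierStokesRegularity.FluidComputer.BurgersTubeHeredity

open Matrix

section AxisGradient

/-! The velocity gradient at the axis stagnation point of the columnar swirl
`u = −(σ r/2) e_r + r Ω(r) e_θ + σ z e_z`: in Cartesian components
`(u_x, u_y, u_z) = (−σx/2 − Ω(r) y, Ω(r) x − σ y/2, σ z)`, so at the origin
`∇u = !![−σ/2, −Ω₀, 0; Ω₀, −σ/2, 0; 0, 0, σ]` with `Ω₀ = Ω(0)`. The matrix is written out literally in
every statement (no definitions in this file). -/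

/-- Incompressibility at the stagnation point: `tr ∇u = 0`. -/
theorem trace_burgersGrad (σ Ω₀ : ℝ) :
    (!![-σ / 2, -Ω₀, 0; Ω₀, -σ / 2, 0; 0, 0, σ] : Matrix (Fin 3) (Fin 3) ℝ).trace = 0 := by
  simp [Matrix.trace, Fin.sum_univ_three]

/-- The symmetric part `∇u + ∇uᵀ = diag(−σ, −σ, 2σ)` is twice the PARENT's axisymmetric strain
`diag(−σ/2, −σ/2, σ)`: the swirl `Ω₀` drops out — the tube contributes rotation, not strain, at its
own axis (HEREDITY-P3 (A)(i)). -/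
theorem burgersGrad_add_transpose (σ Ω₀ : ℝ) :
    (!![-σ / 2, -Ω₀, 0; Ω₀, -σ / 2, 0; 0, 0, σ] : Matrix (Fin 3) (Fin 3) ℝ) + !![-σ / 2, -Ω₀, 0; Ω₀, -σ / 2, 0; 0, 0, σ]ᵀ =
      !![-σ, 0, 0; 0, -σ, 0; 0, 0, 2 * σ] := by
  ext i j
  fin_cases i <;> fin_cases j <;> simp [two_mul]

/-- `det ∇u = σ (σ²/4 + Ω₀²)`. -/
theorem det_burgersGrad (σ Ω₀ : ℝ) :
    (!![-σ / 2, -Ω₀, 0; Ω₀, -σ / 2, 0; 0, 0, σ] : Matrix (Fin 3) (Fin 3) ℝ).det = σ * (σ ^ 2 / 4 + Ω₀ ^ 2) := by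
  simp [Matrix.det_fin_three]
  ring

/-- The axis stagnation point is non-degenerate (`det ∇u ≠ 0`) as soon as the parent strains
(`σ ≠ 0`). -/
theorem det_burgersGrad_ne_zero {σ : ℝ} (Ω₀ : ℝ) (hσ : σ ≠ 0) :
    (!![-σ / 2, -Ω₀, 0; Ω₀, -σ / 2, 0; 0, 0, σ] : Matrix (Fin 3) (Fin 3) ℝ).det ≠ 0 := by
  rw [det_burgersGrad]
  have hσ2 : 0 < σ ^ 2 := by positivity
  have hpos : 0 < σ ^ 2 / 4 + Ω₀ ^ 2 := by positivity
  exact mul_ne_zero hσ (ne_of_gt hpos)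

/-- The shifted matrix `∇u − μ·1`, entrywise. -/
theorem burgersGrad_sub_smul_one (σ Ω₀ μ : ℝ) :
    (!![-σ / 2, -Ω₀, 0; Ω₀, -σ / 2, 0; 0, 0, σ] : Matrix (Fin 3) (Fin 3) ℝ) - μ • (1 : Matrix (Fin 3) (Fin 3) ℝ) =
      !![-σ / 2 - μ, -Ω₀, 0; Ω₀, -σ / 2 - μ, 0; 0, 0, σ - μ] := by
  ext i j
  fin_cases i <;> fin_cases j <;> simp

/-- Real characteristic polynomial, factored: `det(∇u − μ) = (σ − μ)((μ + σ/2)² + Ω₀²)` — the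
spectrum is `{σ, −σ/2 ± iΩ₀}` (HEREDITY-P3 (A)(i); MARGIN-LEG ML2.1 «a Burgers core's centre gradient
has spectrum {σ, −σ/2 ± iΩ}»). -/
theorem det_burgersGrad_sub (σ Ω₀ μ : ℝ) :
    ((!![-σ / 2, -Ω₀, 0; Ω₀, -σ / 2, 0; 0, 0, σ] : Matrix (Fin 3) (Fin 3) ℝ) - μ • (1 : Matrix (Fin 3) (Fin 3) ℝ)).det =
      (σ - μ) * ((μ + σ / 2) ^ 2 + Ω₀ ^ 2) := by
  rw [burgersGrad_sub_smul_one]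
  simp [Matrix.det_fin_three]
  ring

/-- For a genuinely swirling tube (`Ω₀ ≠ 0`) the ONLY real eigenvalue of the axis gradient is the
parent's stretching rate `σ`: the transverse dynamics is a spiral (`−σ/2 ± iΩ₀`), offering a
would-be child no new real stretching direction (HEREDITY-P3 (A)). -/
theorem real_eigenvalue_eq {σ Ω₀ μ : ℝ} (hΩ : Ω₀ ≠ 0)
    (h : ((!![-σ / 2, -Ω₀, 0; Ω₀, -σ / 2, 0; 0, 0, σ] : Matrix (Fin 3) (Fin 3) ℝ) - μ • (1 : Matrix (Fin 3) (Fin 3) ℝ)).det = 0) :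
    μ = σ := by
  rw [det_burgersGrad_sub] at h
  have hΩ2 : 0 < Ω₀ ^ 2 := by positivity
  have hpos : 0 < (μ + σ / 2) ^ 2 + Ω₀ ^ 2 := by positivity
  rcases mul_eq_zero.mp h with h1 | h2
  · linarith
  · exact absurd h2 (ne_of_gt hpos)

/-- Conversely `σ` IS an eigenvalue: the axis direction `e_z = (0,0,1)` is stretched at the parent's
rate, `∇u · e_z = σ e_z`. -/
theorem mulVec_axis (σ Ω₀ : ℝ) :
    (!![-σ / 2, -Ω₀, 0; Ω₀, -σ / 2, 0; 0, 0, σ] : Matrix (Fin 3) (Fin 3) ℝ).mulVec ![0, 0, 1] = σ • ![0, 0, 1] := by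
  ext i
  fin_cases i <;> simp [Matrix.mulVec, dotProduct, Fin.sum_univ_three]

end AxisGradient

section OseenStrain

/-! The Lamb–Oseen defect `1 − (1 + y) e^{−y}` (`y = r²/a²`) is the circulation-profile factor in
the strain of a Gaussian vortex core; the normalised strain at `r = x·a` is
`s(x) = (1 − (1 + x²) e^{−x²}) / (2x²)` (units of the peak vorticity `ω₀`). Both are written out
literally below (no definitions in this file). -/

/-- `0 ≤ 1 − (1+y)e^{−y}` for EVERY real `y` (from `1 + y ≤ e^y`). -/
theorem oseenDefect_nonneg (y : ℝ) : 0 ≤ (1 - (1 + y) * Real.exp (-y)) := by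
  have h1 : 1 + y ≤ Real.exp y := by linarith [Real.add_one_le_exp y]
  have h2 : (1 + y) * Real.exp (-y) ≤ Real.exp y * Real.exp (-y) :=
    mul_le_mul_of_nonneg_right h1 (Real.exp_nonneg _)
  have h3 : Real.exp y * Real.exp (-y) = 1 := by
    rw [← Real.exp_add, add_neg_cancel, Real.exp_zero]
  linarith

/-- `1 − (1+y)e^{−y} ≤ 1` for `y ≥ 0`. -/
theorem oseenDefect_le_one {y : ℝ} (hy : 0 ≤ y) : (1 - (1 + y) * Real.exp (-y)) ≤ 1 := by
  have h1 : 0 ≤ 1 + y := by linarith [hy]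
  have : 0 ≤ (1 + y) * Real.exp (-y) := mul_nonneg h1 (Real.exp_nonneg _)
  linarith

/-- Derivative of the comparison function `g(y) = y²/2 − 1 + (1+y)e^{−y}`: `g'(y) = y(1 − e^{−y})`. -/
theorem hasDerivAt_oseenAux (y : ℝ) :
    HasDerivAt (fun t : ℝ => t ^ 2 / 2 - 1 + (1 + t) * Real.exp (-t))
      (y * (1 - Real.exp (-y))) y := by
  have h1 : HasDerivAt (fun t : ℝ => t ^ 2 / 2 - 1) y y :=
    (((hasDerivAt_pow 2 y).div_const 2).sub_const 1).congr_deriv (by norm_num)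
  have ha : HasDerivAt (fun t : ℝ => 1 + t) 1 y := by
    simpa using (hasDerivAt_id y).const_add 1
  have hb : HasDerivAt (fun t : ℝ => Real.exp (-t)) (-Real.exp (-y)) y := by
    have h := (hasDerivAt_neg y).exp
    simpa using h
  have h2 : HasDerivAt (fun t : ℝ => (1 + t) * Real.exp (-t))
      (1 * Real.exp (-y) + (1 + y) * (-Real.exp (-y))) y := ha.mul hb
  exact (h1.add h2).congr_deriv (by ring)

/-- The sharp elementary bound `1 − (1+y)e^{−y} ≤ y²/2` for `y ≥ 0` (the comparison function
`y²/2 − 1 + (1+y)e^{−y}` vanishes at `0` and has derivative `y(1 − e^{−y}) ≥ 0`). -/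
theorem oseenDefect_le_sq_half {y : ℝ} (hy : 0 ≤ y) : (1 - (1 + y) * Real.exp (-y)) ≤ y ^ 2 / 2 := by
  let g : ℝ → ℝ := fun t => t ^ 2 / 2 - 1 + (1 + t) * Real.exp (-t)
  have hcont : Continuous g := by
    unfold g
    fun_prop
  have hmono : MonotoneOn g (Set.Ici 0) := by
    apply monotoneOn_of_deriv_nonneg (convex_Ici 0) hcont.continuousOn
    · intro x _
      exact (hasDerivAt_oseenAux x).differentiableAt.differentiableWithinAt
    · intro x hx
      rw [interior_Ici] at hx
      rw [(hasDerivAt_oseenAux x).deriv]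
      have hx' : 0 ≤ x := le_of_lt hx
      have hexp : Real.exp (-x) ≤ 1 := by
        rw [Real.exp_le_one_iff]
        linarith
      exact mul_nonneg hx' (by linarith)
  have h0 : g 0 = 0 := by simp [g]
  have hle : g 0 ≤ g y := hmono (Set.mem_Ici.mpr le_rfl) (Set.mem_Ici.mpr hy) hy
  rw [h0] at hle
  have : g y = y ^ 2 / 2 - 1 + (1 + y) * Real.exp (-y) := rfl
  linarith

/-- `s(x) ≥ 0` (at `x = 0` the quotient is `0/0 = 0` in Lean, also the true limit). -/
theorem oseenStrain_nonneg (x : ℝ) :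
    0 ≤ (1 - (1 + x ^ 2) * Real.exp (-x ^ 2)) / (2 * x ^ 2) :=
  div_nonneg (oseenDefect_nonneg (x ^ 2)) (by positivity)

/-- Far-field (point-vortex) bound `s(x) ≤ 1/(2x²)`. -/
theorem oseenStrain_le_far (x : ℝ) :
    (1 - (1 + x ^ 2) * Real.exp (-x ^ 2)) / (2 * x ^ 2) ≤ 1 / (2 * x ^ 2) := by
  by_cases hx : x = 0
  · subst hx
    simp
  · have hpos : 0 < 2 * x ^ 2 := by positivity
    exact div_le_div_of_nonneg_right (oseenDefect_le_one (sq_nonneg x)) hpos.le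

/-- Near-axis (solid-body core) bound `s(x) ≤ x²/4`. -/
theorem oseenStrain_le_near (x : ℝ) :
    (1 - (1 + x ^ 2) * Real.exp (-x ^ 2)) / (2 * x ^ 2) ≤ x ^ 2 / 4 := by
  by_cases hx : x = 0
  · subst hx
    simp
  · have hpos : 0 < 2 * x ^ 2 := by positivity
    rw [div_le_iff₀ hpos]
    have h := oseenDefect_le_sq_half (sq_nonneg x)
    nlinarith [sq_nonneg x]

/-- GLOBAL STRAIN BOUND (HEREDITY-P3 (B), kernel form): `s(x) ≤ √2/4 < 0.36` everywhere — a single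
Gaussian tube of peak vorticity `ω₀` imposes strain at most `0.36 ω₀` at any point (true maximum
`0.149 ω₀` at `r = 1.34a`), whereas the marginal schedule asks the child site for `σ* = ω₀`. -/
theorem oseenStrain_le (x : ℝ) :
    (1 - (1 + x ^ 2) * Real.exp (-x ^ 2)) / (2 * x ^ 2) ≤ Real.sqrt 2 / 4 := by
  have hs2 : Real.sqrt 2 * Real.sqrt 2 = 2 := Real.mul_self_sqrt (by norm_num)
  have hsn : 0 ≤ Real.sqrt 2 := Real.sqrt_nonneg 2
  by_cases h : x ^ 2 ≤ Real.sqrt 2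
  · calc (1 - (1 + x ^ 2) * Real.exp (-x ^ 2)) / (2 * x ^ 2) ≤ x ^ 2 / 4 := oseenStrain_le_near x
      _ ≤ Real.sqrt 2 / 4 := by linarith
  · have h' : Real.sqrt 2 < x ^ 2 := lt_of_not_ge h
    have hpos : 0 < 2 * x ^ 2 := by nlinarith
    calc (1 - (1 + x ^ 2) * Real.exp (-x ^ 2)) / (2 * x ^ 2)
          ≤ 1 / (2 * x ^ 2) := oseenStrain_le_far x
      _ ≤ Real.sqrt 2 / 4 := by
        rw [div_le_div_iff₀ hpos (by norm_num : (0 : ℝ) < 4)]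
        nlinarith

/-- Corollary in the memo's words: the strain efficiency of ONE tube is `< 1` — indeed `< 0.36` —
uniformly (`√2/4 < 0.36`). -/
theorem oseenStrain_lt (x : ℝ) :
    (1 - (1 + x ^ 2) * Real.exp (-x ^ 2)) / (2 * x ^ 2) < 0.36 := by
  have h := oseenStrain_le x
  have hs : Real.sqrt 2 < 1.42 := by
    rw [Real.sqrt_lt' (by norm_num)]
    norm_num
  linarith

/-- Two tubes (strain tensors add at most in operator norm): the normalised strain two equal
Gaussian tubes can impose at any point is `< 0.72 < 1` — still below the schedule's `σ* = ω₀`. -/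
theorem two_oseenStrain_lt (x₁ x₂ : ℝ) :
    (1 - (1 + x₁ ^ 2) * Real.exp (-x₁ ^ 2)) / (2 * x₁ ^ 2) +
      (1 - (1 + x₂ ^ 2) * Real.exp (-x₂ ^ 2)) / (2 * x₂ ^ 2) < 0.72 := by
  have h1 := oseenStrain_lt x₁
  have h2 := oseenStrain_lt x₂
  linarith

end OseenStrain


section LinearFlow

/-! ### (A)(ii)–(iii), linear part: the linearised flow `exp(t ∇u)` at the axis, written out

For the CONSTANT-coefficient linearisation `ẋ = ∇u · x` with `∇u = !![−σ/2, −Ω₀, 0; Ω₀, −σ/2, 0; 0, 0, σ]`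
the solution operator is the explicit matrix
`Φ(t) = !![e^{−σt/2} cos Ω₀t, −e^{−σt/2} sin Ω₀t, 0; e^{−σt/2} sin Ω₀t, e^{−σt/2} cos Ω₀t, 0; 0, 0, e^{σt}]`:
we check `Φ(0) = 1`, the matrix ODE `Φ' = ∇u · Φ` entrywise, and the EXACT energy split
`|Φ(t)v|² = e^{−σt}(v₀² + v₁²) + e^{2σt} v₂²` — independent of the swirl `Ω₀`: the transverse pair
contracts at the parent's rate `−σ/2`, the axis stretches at `σ`, and the rotation contributes nothing to
growth (Lyapunov spectrum `{σ, −σ/2, −σ/2}` of the linearised flow; HEREDITY-P3 (A)(iii) for the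
nonlinear columnar flow is the memo's paper-grade statement). -/

/-- `Φ(0) = 1`. -/
theorem linFlow_zero (σ Ω₀ : ℝ) :
    (!![Real.exp (-σ * 0 / 2) * Real.cos (Ω₀ * 0), -(Real.exp (-σ * 0 / 2) * Real.sin (Ω₀ * 0)), 0;
        Real.exp (-σ * 0 / 2) * Real.sin (Ω₀ * 0), Real.exp (-σ * 0 / 2) * Real.cos (Ω₀ * 0), 0;
        0, 0, Real.exp (σ * 0)] : Matrix (Fin 3) (Fin 3) ℝ) = 1 := by
  ext i j
  fin_cases i <;> fin_cases j <;> simp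

/-- The product `∇u · Φ(t)`, entrywise (pure algebra). -/
theorem burgersGrad_mul_linFlow (σ Ω₀ E c s F : ℝ) :
    (!![-σ / 2, -Ω₀, 0; Ω₀, -σ / 2, 0; 0, 0, σ] : Matrix (Fin 3) (Fin 3) ℝ) *
        !![E * c, -(E * s), 0; E * s, E * c, 0; 0, 0, F] =
      !![-(σ / 2) * (E * c) - Ω₀ * (E * s), σ / 2 * (E * s) - Ω₀ * (E * c), 0;
         Ω₀ * (E * c) - σ / 2 * (E * s), -(Ω₀ * (E * s)) - σ / 2 * (E * c), 0;
         0, 0, σ * F] := by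
  ext i j
  fin_cases i <;> fin_cases j <;> simp [Matrix.mul_apply, Fin.sum_univ_three] <;> ring

/-- Derivative of the decaying-rotating factor `e^{−σt/2} cos Ω₀t`. -/
theorem hasDerivAt_exp_cos (σ Ω₀ t : ℝ) :
    HasDerivAt (fun τ : ℝ => Real.exp (-σ * τ / 2) * Real.cos (Ω₀ * τ))
      (-(σ / 2) * (Real.exp (-σ * t / 2) * Real.cos (Ω₀ * t))
        - Ω₀ * (Real.exp (-σ * t / 2) * Real.sin (Ω₀ * t))) t := by
  have hE : HasDerivAt (fun τ : ℝ => Real.exp (-σ * τ / 2)) (Real.exp (-σ * t / 2) * (-σ / 2)) t := by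
    have h := ((hasDerivAt_id t).const_mul (-σ)).div_const 2
    simpa using h.exp
  have hc : HasDerivAt (fun τ : ℝ => Real.cos (Ω₀ * τ)) (-Real.sin (Ω₀ * t) * Ω₀) t := by
    have h := (hasDerivAt_id t).const_mul Ω₀
    simpa using h.cos
  exact (hE.mul hc).congr_deriv (by ring)

/-- Derivative of `e^{−σt/2} sin Ω₀t`. -/
theorem hasDerivAt_exp_sin (σ Ω₀ t : ℝ) :
    HasDerivAt (fun τ : ℝ => Real.exp (-σ * τ / 2) * Real.sin (Ω₀ * τ))
      (Ω₀ * (Real.exp (-σ * t / 2) * Real.cos (Ω₀ * t))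
        - σ / 2 * (Real.exp (-σ * t / 2) * Real.sin (Ω₀ * t))) t := by
  have hE : HasDerivAt (fun τ : ℝ => Real.exp (-σ * τ / 2)) (Real.exp (-σ * t / 2) * (-σ / 2)) t := by
    have h := ((hasDerivAt_id t).const_mul (-σ)).div_const 2
    simpa using h.exp
  have hs : HasDerivAt (fun τ : ℝ => Real.sin (Ω₀ * τ)) (Real.cos (Ω₀ * t) * Ω₀) t := by
    have h := (hasDerivAt_id t).const_mul Ω₀
    simpa using h.sin
  exact (hE.mul hs).congr_deriv (by ring)

/-- Derivative of the axial factor `e^{σt}`. -/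
theorem hasDerivAt_exp_axial (σ t : ℝ) :
    HasDerivAt (fun τ : ℝ => Real.exp (σ * τ)) (σ * Real.exp (σ * t)) t := by
  have h := ((hasDerivAt_id t).const_mul σ).exp
  simpa [mul_comm] using h

/-- **The matrix ODE `Φ'(t) = ∇u · Φ(t)`, entrywise.** With `E = e^{−σt/2}`, `c = cos Ω₀t`,
`s = sin Ω₀t`, `F = e^{σt}`, the nine entries of `Φ` have exactly the derivatives listed in
`burgersGrad_mul_linFlow` (the three non-trivial patterns are `hasDerivAt_exp_cos`,
`hasDerivAt_exp_sin`, `hasDerivAt_exp_axial`; the `−E s` entry is the negative of the second; the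
zero entries are constant). Stated here for the `(0,0)`, `(1,0)`, `(0,1)` and `(2,2)` entries, which
generate the rest by sign. -/
theorem linFlow_hasDerivAt_entries (σ Ω₀ t : ℝ) :
    HasDerivAt (fun τ : ℝ => Real.exp (-σ * τ / 2) * Real.cos (Ω₀ * τ))
        (-(σ / 2) * (Real.exp (-σ * t / 2) * Real.cos (Ω₀ * t))
          - Ω₀ * (Real.exp (-σ * t / 2) * Real.sin (Ω₀ * t))) t ∧
      HasDerivAt (fun τ : ℝ => Real.exp (-σ * τ / 2) * Real.sin (Ω₀ * τ))
        (Ω₀ * (Real.exp (-σ * t / 2) * Real.cos (Ω₀ * t))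
          - σ / 2 * (Real.exp (-σ * t / 2) * Real.sin (Ω₀ * t))) t ∧
      HasDerivAt (fun τ : ℝ => -(Real.exp (-σ * τ / 2) * Real.sin (Ω₀ * τ)))
        (σ / 2 * (Real.exp (-σ * t / 2) * Real.sin (Ω₀ * t))
          - Ω₀ * (Real.exp (-σ * t / 2) * Real.cos (Ω₀ * t))) t ∧
      HasDerivAt (fun τ : ℝ => Real.exp (σ * τ)) (σ * Real.exp (σ * t)) t := by
  refine ⟨hasDerivAt_exp_cos σ Ω₀ t, hasDerivAt_exp_sin σ Ω₀ t, ?_, hasDerivAt_exp_axial σ t⟩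
  exact (hasDerivAt_exp_sin σ Ω₀ t).neg.congr_deriv (by ring)

/-- **Energy split of the linearised flow, independent of the swirl.** For any `v`,
`|Φ(t)v|² = e^{−σt}(v₀² + v₁²) + e^{2σt} v₂²` (`cos² + sin² = 1`): the transverse components decay
like `e^{−σt/2}`, the axial one grows like `e^{σt}`, and `Ω₀` does not appear — the Lyapunov spectrum
of the linearised flow is the PARENT's `{σ, −σ/2, −σ/2}` (HEREDITY-P3 (A)(iii), linear part). -/
theorem linFlow_norm_sq (σ Ω₀ t : ℝ) (v : Fin 3 → ℝ) :
    let w := (!![Real.exp (-σ * t / 2) * Real.cos (Ω₀ * t), -(Real.exp (-σ * t / 2) * Real.sin (Ω₀ * t)), 0;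
        Real.exp (-σ * t / 2) * Real.sin (Ω₀ * t), Real.exp (-σ * t / 2) * Real.cos (Ω₀ * t), 0;
        0, 0, Real.exp (σ * t)] : Matrix (Fin 3) (Fin 3) ℝ).mulVec v
    w 0 ^ 2 + w 1 ^ 2 + w 2 ^ 2 =
      Real.exp (-σ * t / 2) ^ 2 * (v 0 ^ 2 + v 1 ^ 2) + Real.exp (σ * t) ^ 2 * v 2 ^ 2 := by
  intro w
  have hcs : Real.cos (Ω₀ * t) ^ 2 + Real.sin (Ω₀ * t) ^ 2 = 1 := Real.cos_sq_add_sin_sq _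
  simp only [w, Matrix.mulVec, dotProduct, Fin.sum_univ_three, Matrix.of_apply, Matrix.cons_val',
    Matrix.cons_val_zero, Matrix.cons_val_one, Matrix.cons_val_two, Matrix.empty_val',
    Matrix.cons_val_fin_one, Matrix.head_cons, Matrix.tail_cons, Matrix.head_fin_const]
  nlinarith [hcs]

/-- The transverse factor is exactly `e^{−σt}`: `(e^{−σt/2})² = e^{−σt}` (so the transverse ENERGY
decays at the parent's rate `σ`, whatever `Ω₀`). -/
theorem exp_half_sq (σ t : ℝ) : Real.exp (-σ * t / 2) ^ 2 = Real.exp (-σ * t) := by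
  rw [← Real.exp_nat_mul]
  congr 1
  ring

end LinearFlow

end Summit.NavierStokesRegularity.FluidComputer.BurgersTubeHeredity
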